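/-
Copyright: the b2b-balaban T⁴-continuum CRUX team, row NE7b owner lineage `t4-ne7b-p1` (gen 115). Project licence.
-/
import Summits.QuantumFields.BalabanUV.T4Continuum.Spine.NE7b.SupBackgroundLocalisation

/-!
# THE LOCALISATION LETTERS READ AS FAR-SUPPORT BOUNDS: for any map obeying a weighted letter of (63) §4 ∕ (64) §4 ∕ (65) ∕ (66) shape
# uniformly over the bounded 1-Lipschitz coarse weights at a rate `μ ≥ 0`, data supported at coarse distance `≥ D` from `blk p` are
# read at `p` with the factor `e^{−μD}` — three plain-form corollaries of (63) §3 `abs_le_of_far`: the background RESPONSE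
# (`|(Dσ(w)v)(p)| ≤ K‖v‖e^{−μD}` for `v ≡ 0` on the `D`-ball), the fluctuation COVARIANCE (`|(C̃(w)f)(p)| ≤ K‖f‖e^{−μD}` for `f ≡ 0`
# on the blocks over the `D`-ball), and the BACKGROUND itself (`|(σw′ − σw)(p)| ≤ K‖w′ − w‖e^{−μD}` when `w′ − w ≡ 0` on the `D`-ball)
# (row NE7b, node U5c; (63) §3 BY NAME, generic in the displayed letters; [folklore])

Cell `pub-balaban`, sub-cell `t4`, spine estimate NE7b (`T4WeightBudget.RelWeightBound`; the cell's OWN estimate — NOT PRINTED in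
[Bałaban 1983–89], NOT PROVED).  Crux-route work under `Spine/NE7b/` by the row OWNER (`t4-ne7b-p1` gen 115) under FREEZE (0)'s
crux-prover clause (FILING-CLAIM C-ne7bp1-g115-10); NOTHING of Bałaban's is named, valued or asserted; no `def`, no notation; zero
`sorry`.  Imports (BY NAME): the owner's (63) `…SupBackgroundLocalisation` (`abs_le_of_far`, through it (58) `abs_apply_le_norm`).

WHY (located).  (63)–(66) state every localisation as a WEIGHTED letter «for every bounded 1-Lipschitz weight `ρ`»; the sentence a
cluster-expansion consumer (and the pricing desk) reads is the far-support bound with the factor `e^{−μD}`.  (63) §3 is the reader; this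
file applies it once per letter shape, so consumers of (63) §4 (`hDwt`-shape for `Dσ`, `f`-shape for `C̃`) and (64) §4 (a) (`R_w`-shape
for `σ`) get the plain form by `exact`.

WHAT IS PROVED ([folklore]; `ℓ^∞ := lp (fun _ : X d => ℝ) ∞`, `0 ≤ μ`, `0 ≤ K`):
* **`coarse_far_of_letter`**: if `T : ℓ^∞ → ℓ^∞` obeys `e^{μρ(blk p)}|(Tv)(p)| ≤ K·R_v` for every bounded admissible `ρ` and every
  `e^{μρ}|v| ≤ R_v`, then `v ≡ 0` on `{y : |y − blk p|_∞ < D}` ⟹ `|(Tv)(p)| ≤ K·‖v‖·e^{−μD}` (the response `Dσ(w)`; the background's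
  difference map `v = w′ − w ↦ σw′ − σw` via `coarse_far_of_letter'`, stated for a value `t`).
* **`fine_far_of_letter`**: if `C : ℓ^∞ → ℓ^∞` obeys `e^{μρ(blk p)}|(Cf)(p)| ≤ K·R_f` for every bounded admissible `ρ` and every
  `e^{μρ∘blk}|f| ≤ R_f`, then `f ≡ 0` on `{q : |blk q − blk p|_∞ < D}` ⟹ `|(Cf)(p)| ≤ K·‖f‖·e^{−μD}` (the covariance `C̃(w)`).

HONEST (what this is NOT).  Readers only; constants ∕ rates as in (63)–(66) (existential); nothing of Bałaban's.  BY-NAME EFFECT ON THE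
WALL: NONE.  NE7b NOT PRINTED ∕ NOT PROVED; spine PROVED 0∕9; rung (B)+1 on a FINITE torus — NOT infinite volume, NOT the mass gap, NOT
Clay.  HONEST DEPENDENCY: continuum YM on T⁴ ⇐ BetaPertH ∧ nine spine estimates (0∕9 proved); BetaPertH ⇐ (D1) ∧ (D4) ∧ CAP+tail;
G-an2-4 gates asym, D1 and NE2∕3∕4.
-/

set_option autoImplicit false

noncomputable section

namespace Summit.QuantumFields.BalabanUV.T4Continuum.NE7b.SupBackgroundFarSupport

open scoped ENNReal
open Literature.MathematicalPhysics.QuantumFieldTheory.Balaban1983to89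
open B6QGQLower276 (X blk)
open LocalNemytskiiSup (abs_apply_le_norm)
open SupBackgroundLocalisation (abs_le_of_far)

variable {d : ℕ}

/-- **FAR-SUPPORT BOUND FROM A COARSE-DATA WEIGHTED LETTER, VALUE FORM**: if a value `t` (think `(Tv)(p)`) obeys
`e^{μρ(blk p)}|t| ≤ K·R_v` for every bounded admissible `ρ` and every weighted bound `R_v` of the coarse datum `v ∈ ℓ^∞`, and `v`
vanishes on the coarse ball `{y : |y − blk p|_∞ < D}`, then `|t| ≤ K·‖v‖·e^{−μD}`. [folklore] -/
theorem coarse_far_of_letter' (n : ℕ) {μ : ℝ} (hμ0 : 0 ≤ μ) {K : ℝ} (hK : 0 ≤ K) (v : lp (fun _ : X d => ℝ) ∞) (p : X d)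
    {D t : ℝ} (hfar : ∀ y, dist y (blk n p) < D → v y = 0)
    (hletter : ∀ ρ : X d → ℝ, (∀ x y, ρ x - ρ y ≤ dist x y) → (∃ M, ∀ y, |ρ y| ≤ M) →
      ∀ Rv : ℝ, (∀ y, Real.exp (μ * ρ y) * |v y| ≤ Rv) → Real.exp (μ * ρ (blk n p)) * |t| ≤ K * Rv) :
    |t| ≤ K * ‖v‖ * Real.exp (-(μ * D)) := by
  have h := abs_le_of_far n hμ0 (K := K) (Cv := 1) (Cκ := 0) hK zero_le_one le_rfl (v := fun y => v y) (κ₀ := fun _ => 0)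
    (Rv := ‖v‖) (Rκ := 0) (D := D) (t := t) (fun y => abs_apply_le_norm v y) (fun _ => by rw [abs_zero]) p hfar
    (fun _ _ => rfl) (fun ρ hρ hρb Rv' Rκ' hv _ => by rw [one_mul, zero_mul, add_zero]; exact hletter ρ hρ hρb Rv' hv)
  rwa [one_mul, zero_mul, add_zero] at h

/-- **FAR-SUPPORT BOUND FOR A COARSE-TO-FINE MAP** (the response `Dσ(w)` of (63) §4, or any `T` with its letter): if
`e^{μρ(blk p)}|(Tv)(p)| ≤ K·R_v` for every bounded admissible `ρ`, every `v` and every weighted bound `R_v`, then for `v` vanishing on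
`{y : |y − blk p|_∞ < D}`: `|(Tv)(p)| ≤ K·‖v‖·e^{−μD}`. [folklore] -/
theorem coarse_far_of_letter (n : ℕ) {μ : ℝ} (hμ0 : 0 ≤ μ) {K : ℝ} (hK : 0 ≤ K)
    (T : lp (fun _ : X d => ℝ) ∞ → lp (fun _ : X d => ℝ) ∞)
    (hletter : ∀ ρ : X d → ℝ, (∀ x y, ρ x - ρ y ≤ dist x y) → (∃ M, ∀ y, |ρ y| ≤ M) →
      ∀ (v : lp (fun _ : X d => ℝ) ∞) (Rv : ℝ), (∀ y, Real.exp (μ * ρ y) * |v y| ≤ Rv) →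
        ∀ p : X d, Real.exp (μ * ρ (blk n p)) * |T v p| ≤ K * Rv)
    (v : lp (fun _ : X d => ℝ) ∞) (p : X d) {D : ℝ} (hfar : ∀ y, dist y (blk n p) < D → v y = 0) :
    |T v p| ≤ K * ‖v‖ * Real.exp (-(μ * D)) :=
  coarse_far_of_letter' n hμ0 hK v p hfar fun ρ hρ hρb Rv hv => hletter ρ hρ hρb v Rv hv p

/-- **FAR-SUPPORT BOUND FOR A FINE-TO-FINE MAP** (the covariance `C̃(w)` of (63) §4, or any `C` with its letter): if
`e^{μρ(blk p)}|(Cf)(p)| ≤ K·R_f` for every bounded admissible `ρ`, every `f` and every weighted bound `R_f` (weight `ρ∘blk`), then for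
`f` vanishing on the blocks `{q : |blk q − blk p|_∞ < D}`: `|(Cf)(p)| ≤ K·‖f‖·e^{−μD}`. [folklore] -/
theorem fine_far_of_letter (n : ℕ) {μ : ℝ} (hμ0 : 0 ≤ μ) {K : ℝ} (hK : 0 ≤ K)
    (C : lp (fun _ : X d => ℝ) ∞ → lp (fun _ : X d => ℝ) ∞)
    (hletter : ∀ ρ : X d → ℝ, (∀ x y, ρ x - ρ y ≤ dist x y) → (∃ M, ∀ y, |ρ y| ≤ M) →
      ∀ (f : lp (fun _ : X d => ℝ) ∞) (Rf : ℝ), (∀ q, Real.exp (μ * ρ (blk n q)) * |f q| ≤ Rf) →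
        ∀ p : X d, Real.exp (μ * ρ (blk n p)) * |C f p| ≤ K * Rf)
    (f : lp (fun _ : X d => ℝ) ∞) (p : X d) {D : ℝ} (hfar : ∀ q, dist (blk n q) (blk n p) < D → f q = 0) :
    |C f p| ≤ K * ‖f‖ * Real.exp (-(μ * D)) := by
  have h := abs_le_of_far n hμ0 (K := K) (Cv := 0) (Cκ := 1) hK le_rfl zero_le_one (v := fun _ => 0) (κ₀ := fun q => f q)
    (Rv := 0) (Rκ := ‖f‖) (D := D) (t := C f p) (fun _ => by rw [abs_zero]) (fun q => abs_apply_le_norm f q) p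
    (fun _ _ => rfl) hfar
    (fun ρ hρ hρb Rv' Rκ' _ hf => by rw [zero_mul, zero_add, one_mul]; exact hletter ρ hρ hρb f Rκ' hf p)
  rwa [zero_mul, zero_add, one_mul] at h

/-! ## Toy -/

/-- Toy: a map whose letter constant is `0` reads far data as `0`. -/
example (n : ℕ) (T : lp (fun _ : X d => ℝ) ∞ → lp (fun _ : X d => ℝ) ∞)
    (hT : ∀ ρ : X d → ℝ, (∀ x y, ρ x - ρ y ≤ dist x y) → (∃ M, ∀ y, |ρ y| ≤ M) →
      ∀ (v : lp (fun _ : X d => ℝ) ∞) (Rv : ℝ), (∀ y, Real.exp (0 * ρ y) * |v y| ≤ Rv) →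
        ∀ p : X d, Real.exp (0 * ρ (blk n p)) * |T v p| ≤ 0 * Rv)
    (v : lp (fun _ : X d => ℝ) ∞) (p : X d) (hfar : ∀ y, dist y (blk n p) < 1 → v y = 0) :
    |T v p| ≤ 0 * ‖v‖ * Real.exp (-(0 * 1)) :=
  coarse_far_of_letter n le_rfl le_rfl T hT v p hfar

end Summit.QuantumFields.BalabanUV.T4Continuum.NE7b.SupBackgroundFarSupport

end
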